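import Summits.BirchSwinnertonDyer.BirchSwinnertonDyer.Theorems.ResidualThetaTransportAtTwoThetaLayerLambdaCongruenceAtTwoHeckeAdjointFareyBookkeeping
import HarnessLib

/-!
# Crux `ThetaLayerLambdaCongruenceAtTwo` (stmt-BirchSwinnertonDyer-20688, route ResidualThetaTransportAtTwo), line
# `birth` v14 — SD floor, kernel road, Hecke clause of IP, brick HA7b «MANIN-SIDE ANCHORS»: Manin chains for a Hecke cocycle whose
# representatives do NOT fix `∞` (the transposed operators `T♯_q`, `q ∣ N`), and the cancellation of the anchor paths (lead prover
# bsd-wall-rtt-p3 g13; `--supports stmt-BirchSwinnertonDyer-20688 --as helper`; closes nothing)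

HONEST FRAMING. Elementary THEOREMS about lists of elements of `SL₂(ℤ)` and `2×2` integer matrices, in the currency of `…ManinChain`,
`…HeckeAdjointFareyBookkeeping` (HA7, w2 g8) and `…HeckeAdjointConvexReexpansion` (HA4); no definition; nothing about any curve or form is
asserted; BSD is not proved by any of this.

WHY (memo `Cruxes/ThetaLayerLambdaCongruenceAtTwo/Lines/birth-sd2-hecke-adjoint.md` §3 (D), «anchors at ∞ cancel as in (A)»). In the
transpose-adjointness identity `B (T_p • x) y = B x (T♯_p y)` (`ip_of_crossingPairing_transposeAdjoint`, w4 g7) the SECOND slot of the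
crossing pairing is the MANIN-chain side, and it carries the TRANSPOSED operator `T♯_p`, whose cocycle `M̃_i γ' = ε_i M̃_{σ i}` has integer
representatives `M̃_i` (`det > 0`) that do NOT fix the cusp `∞` (`w_N (1 j; 0 p) w_N⁻¹ = (p 0; −Nj 1)`; for `q ∣ N` the double coset
`Γ₀(N) diag(q,1) Γ₀(N)` has no `∞`-fixing right-coset representatives at all). HA7 (`flatMap_reexpansion_isManinChain`) re-expands `M·L(γ')`
into a Manin chain of `δ` only for UPPER-triangular `M, M_σ`. THIS FILE removes that restriction:
* §1 `flatMap_reexpansion_telescopes`: for ANY integer `M` with `det M ≠ 0`, the concatenated re-expansion of `M·L(γ')` telescopes over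
  cusp functions between anchors of the cusps `M∞` and `Mγ'∞`;
* §2 `exists_maninChains_of_cocycle`: for a cocycle `M_i·γ' = ε_i·M_{σ i}` (`ε_i ∈ Γ₀(N)`, `σ` a permutation, `M_i` arbitrary integer
  matrices with `det ≠ 0`) the lists `Lε_i := A_i ++ (re-expanded M_i·L(γ')) ++ ε_i·(A_{σ i} reversed)` — `A_i` a Manin chain of an anchor
  `k_i` of the cusp `M_i∞` — are universal Manin chains of the `ε_i`, AND for every `Φ : SL₂(ℤ) → A` which is left-`Γ₀(N)`-invariant and
  `S`-antisymmetric (`Φ(fS) = −Φ f`; e.g. `Φ f = vec D_γ [f⁻¹]`, the crossing count against a fixed dual chain, by `dualChainVec_smul_S`)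
  the anchor paths cancel: `Σ_i Σ_{f ∈ Lε_i} Φ f = Σ_i Σ_{g ∈ L(γ')} Σ_{f ∈ P(M_i g)} Φ f`.
So `B(x, T♯ y) = Σ_i B(per γ, per ε_i)` can be computed on the re-expanded translated chains `M̃_i·L(γ')` exactly as on the dual side (HA1).

References: [Manin1972] §1.5–1.7, Thm. 1.6; [Merel1994] §1.2–1.3 (Manin symbols and Hecke representatives); [Shimura1971] §3.1–3.3
(coset permutations `Γ α_i γ = Γ α_{σ i}`).
-/

set_option autoImplicit false

noncomputable section

-- justification: the `Summit.BirchSwinnertonDyer.BirchSwinnertonDyer.…` path repeats a component (route-file convention)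
set_option linter.dupNamespace false

open scoped Classical MatrixGroups

open CongruenceSubgroup Matrix.SpecialLinearGroup ModularGroup
open Literature.NumberTheory.EllipticCurves.ModularForms

namespace Summit.BirchSwinnertonDyer.BirchSwinnertonDyer.Theorems.ThetaLayerLambdaCongruenceAtTwo

universe u

/-! ## §1. The concatenated re-expansion of `M·L(γ')` telescopes between the cusps `M∞` and `Mγ'∞` -/

section Telescoping

/-- Parallelism of first columns is preserved by left multiplication with an `SL₂(ℤ)` matrix: if `(a, c) ∥ k e₀` then
`e·(a, c) ∥ (e k) e₀`. [folklore] -/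
theorem col_parallel_mul_left (e k : SL(2, ℤ)) (a c : ℤ) (h : a * k 1 0 = c * k 0 0) :
    (e 0 0 * a + e 0 1 * c) * (e * k) 1 0 = (e 1 0 * a + e 1 1 * c) * (e * k) 0 0 := by
  have hdet : e 0 0 * e 1 1 - e 0 1 * e 1 0 = 1 := by
    have := Matrix.det_fin_two e.1
    rw [e.2] at this
    linear_combination -this
  simp only [coe_mul, Matrix.mul_apply, Fin.sum_univ_two]
  linear_combination (e 0 0 * e 1 1 - e 0 1 * e 1 0) * h

/-- **HA7 without the upper-triangular hypothesis.** Let `M` be an integer matrix with `det M ≠ 0`, `L` a universal Manin chain of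
`γ'` and `P g` (for `g ∈ L`) lists with the anchored telescoping property of brick HA4 for the generalised edge `(M g)·{∞, 0}`. Then the
concatenation `L.flatMap P` telescopes over every cusp function `F` between ANY anchors `k₀` of the cusp `M∞` and `k₁` of the cusp `Mγ'∞`:
`Σ_{f} (F f − F(fS)) = F k₁ − F k₀`. (Proof as in `flatMap_reexpansion_isManinChain`: the auxiliary cusp function `G g = F(anchor of M g∞)`.)
[cite: Manin1972, Thm. 1.6] [cite: Merel1994, §1.3] -/
theorem flatMap_reexpansion_telescopes {A : Type u} [AddCommGroup A] (F : SL(2, ℤ) → A)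
    (hT : ∀ g, F (g * T) = F g) (hneg : ∀ g, F (-g) = F g)
    (γ' : SL(2, ℤ)) (M : Matrix (Fin 2) (Fin 2) ℤ) (hM : M.det ≠ 0)
    (L : List SL(2, ℤ)) (P : SL(2, ℤ) → List SL(2, ℤ))
    (hL : ∀ G : SL(2, ℤ) → A, (∀ g, G (g * T) = G g) → (∀ g, G (-g) = G g) →
      (L.map fun g ↦ G g - G (g * S)).sum = G γ' - G 1)
    (hP : ∀ g ∈ L, ∀ k₁ k₂ : SL(2, ℤ),
      (M * (g : Matrix (Fin 2) (Fin 2) ℤ)) 0 0 * k₁ 1 0 = (M * (g : Matrix (Fin 2) (Fin 2) ℤ)) 1 0 * k₁ 0 0 →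
      (M * (g : Matrix (Fin 2) (Fin 2) ℤ)) 0 1 * k₂ 1 0 = (M * (g : Matrix (Fin 2) (Fin 2) ℤ)) 1 1 * k₂ 0 0 →
      ((P g).map fun f ↦ F f - F (f * S)).sum = F k₁ - F k₂)
    (k₀ k₁ : SL(2, ℤ)) (hk₀ : M 0 0 * k₀ 1 0 = M 1 0 * k₀ 0 0)
    (hk₁ : (M * (γ' : Matrix (Fin 2) (Fin 2) ℤ)) 0 0 * k₁ 1 0 = (M * (γ' : Matrix (Fin 2) (Fin 2) ℤ)) 1 0 * k₁ 0 0) :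
    ((L.flatMap P).map fun f ↦ F f - F (f * S)).sum = F k₁ - F k₀ := by
  -- an anchor for every non-zero integer column
  have hex : ∀ v : ℤ × ℤ, ∃ k : SL(2, ℤ), (v.1 ≠ 0 ∨ v.2 ≠ 0) → v.1 * k 1 0 = v.2 * k 0 0 := by
    intro v
    by_cases hv : v.1 ≠ 0 ∨ v.2 ≠ 0
    · obtain ⟨k, hk⟩ := exists_anchor v.1 v.2 hv
      exact ⟨k, fun _ ↦ hk⟩
    · exact ⟨1, fun h ↦ absurd h hv⟩
  choose anc hanc using hex
  obtain ⟨G, hG⟩ : ∃ G : SL(2, ℤ) → A, ∀ g : SL(2, ℤ),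
      G g = F (anc ((M * (g : Matrix (Fin 2) (Fin 2) ℤ)) 0 0, (M * (g : Matrix (Fin 2) (Fin 2) ℤ)) 1 0)) :=
    ⟨_, fun _ ↦ rfl⟩
  have hcol : ∀ g : SL(2, ℤ), ∀ i : Fin 2,
      (M * (g : Matrix (Fin 2) (Fin 2) ℤ)) i 0 = M i 0 * g 0 0 + M i 1 * g 1 0 := fun g i ↦ by
    simp [Matrix.mul_apply, Fin.sum_univ_two]
  have hcol1 : ∀ g : SL(2, ℤ), ∀ i : Fin 2,
      (M * (g : Matrix (Fin 2) (Fin 2) ℤ)) i 1 = M i 0 * g 0 1 + M i 1 * g 1 1 := fun g i ↦ by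
    simp [Matrix.mul_apply, Fin.sum_univ_two]
  -- `G` is a cusp function
  have hGT : ∀ g, G (g * T) = G g := fun g ↦ by
    obtain ⟨⟨h0, h1⟩, -, -⟩ := col_mul_T_mul_S g
    rw [hG, hG, hcol, hcol, hcol, hcol, h0, h1]
  have hGneg : ∀ g, G (-g) = G g := fun g ↦ by
    obtain ⟨-, -, ⟨h0, h1⟩⟩ := col_mul_T_mul_S g
    rw [hG, hG]
    have h1' := hanc ((M * (g : Matrix (Fin 2) (Fin 2) ℤ)) 0 0, (M * (g : Matrix (Fin 2) (Fin 2) ℤ)) 1 0)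
      (mul_col_ne_zero M hM g)
    have hvn := mul_col_ne_zero M hM (-g)
    have h2' := hanc ((M * ((-g : SL(2, ℤ)) : Matrix (Fin 2) (Fin 2) ℤ)) 0 0,
      (M * ((-g : SL(2, ℤ)) : Matrix (Fin 2) (Fin 2) ℤ)) 1 0) hvn
    dsimp only at h1' h2'
    set k₃ := anc ((M * ((-g : SL(2, ℤ)) : Matrix (Fin 2) (Fin 2) ℤ)) 0 0,
      (M * ((-g : SL(2, ℤ)) : Matrix (Fin 2) (Fin 2) ℤ)) 1 0) with hk₃
    set k₂ := anc ((M * (g : Matrix (Fin 2) (Fin 2) ℤ)) 0 0, (M * (g : Matrix (Fin 2) (Fin 2) ℤ)) 1 0) with hk₂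
    refine apply_eq_of_col_parallel F hT hneg (col_parallel_trans hvn h2' ?_)
    have en : ∀ i : Fin 2, (M * ((-g : SL(2, ℤ)) : Matrix (Fin 2) (Fin 2) ℤ)) i 0 =
        -((M * (g : Matrix (Fin 2) (Fin 2) ℤ)) i 0) := fun i ↦ by
      rw [hcol, hcol, h0, h1]; ring
    rw [en 0, en 1]
    linear_combination -h1'
  -- each block telescopes between `G g` and `G (gS)`
  have hblock : ∀ g ∈ L, ((P g).map fun f ↦ F f - F (f * S)).sum = G g - G (g * S) := by
    intro g hg
    rw [hG, hG]
    have h1' := hanc ((M * (g : Matrix (Fin 2) (Fin 2) ℤ)) 0 0, (M * (g : Matrix (Fin 2) (Fin 2) ℤ)) 1 0)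
      (mul_col_ne_zero M hM g)
    have h2 := hanc ((M * ((g * S : SL(2, ℤ)) : Matrix (Fin 2) (Fin 2) ℤ)) 0 0,
      (M * ((g * S : SL(2, ℤ)) : Matrix (Fin 2) (Fin 2) ℤ)) 1 0) (mul_col_ne_zero M hM (g * S))
    dsimp only at h1' h2
    set k₃ := anc ((M * (g : Matrix (Fin 2) (Fin 2) ℤ)) 0 0, (M * (g : Matrix (Fin 2) (Fin 2) ℤ)) 1 0) with hk₃
    set k₂ := anc ((M * ((g * S : SL(2, ℤ)) : Matrix (Fin 2) (Fin 2) ℤ)) 0 0,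
      (M * ((g * S : SL(2, ℤ)) : Matrix (Fin 2) (Fin 2) ℤ)) 1 0) with hk₂
    refine hP g hg k₃ k₂ h1' ?_
    obtain ⟨-, ⟨h0, h1⟩, -⟩ := col_mul_T_mul_S g
    have es : ∀ i : Fin 2, (M * ((g * S : SL(2, ℤ)) : Matrix (Fin 2) (Fin 2) ℤ)) i 0 =
        (M * (g : Matrix (Fin 2) (Fin 2) ℤ)) i 1 := fun i ↦ by
      rw [hcol, hcol1, h0, h1]
    rw [← es 0, ← es 1]
    exact h2
  rw [sum_map_flatMap]
  have hLG := hL G hGT hGneg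
  rw [show (L.map fun g ↦ ((P g).map fun f ↦ F f - F (f * S)).sum) = L.map fun g ↦ G g - G (g * S) from
    List.map_congr_left hblock, hLG, hG, hG]
  -- the two anchors at the ends
  congr 1
  · have h2 := hanc ((M * (γ' : Matrix (Fin 2) (Fin 2) ℤ)) 0 0, (M * (γ' : Matrix (Fin 2) (Fin 2) ℤ)) 1 0)
      (mul_col_ne_zero M hM γ')
    dsimp only at h2
    exact apply_eq_of_col_parallel F hT hneg (col_parallel_trans (mul_col_ne_zero M hM γ') h2 hk₁)
  · have hv1 := mul_col_ne_zero M hM 1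
    have h2 := hanc ((M * ((1 : SL(2, ℤ)) : Matrix (Fin 2) (Fin 2) ℤ)) 0 0,
      (M * ((1 : SL(2, ℤ)) : Matrix (Fin 2) (Fin 2) ℤ)) 1 0) hv1
    dsimp only at h2
    set k := anc ((M * ((1 : SL(2, ℤ)) : Matrix (Fin 2) (Fin 2) ℤ)) 0 0,
      (M * ((1 : SL(2, ℤ)) : Matrix (Fin 2) (Fin 2) ℤ)) 1 0) with hk
    have e0 : (M * ((1 : SL(2, ℤ)) : Matrix (Fin 2) (Fin 2) ℤ)) 0 0 = M 0 0 := by simp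
    have e1 : (M * ((1 : SL(2, ℤ)) : Matrix (Fin 2) (Fin 2) ℤ)) 1 0 = M 1 0 := by simp
    rw [e0, e1] at h2 hv1
    exact apply_eq_of_col_parallel F hT hneg (col_parallel_trans hv1 h2 hk₀)

end Telescoping

/-! ## §2. Manin chains for a cocycle with arbitrary representatives; the anchor paths cancel -/

section Anchors

variable {N : ℕ}

/-- **Reversed translated Manin chain.** If `Ak` telescopes over cusp functions from `1` to `k` (`Σ_{a∈Ak} (G a − G(aS)) = G k − G 1`),
then the list `[e·a·S : a ∈ Ak]` telescopes from `e k` to `e`: `Σ (F f − F(fS)) = F e − F(e k)` (the path `e·(∞ → k∞)` run backwards).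
[cite: Manin1972, Thm. 1.6] -/
theorem sum_map_translate_reverse {A : Type u} [AddCommGroup A] (F : SL(2, ℤ) → A)
    (hT : ∀ g, F (g * T) = F g) (hneg : ∀ g, F (-g) = F g) (e k : SL(2, ℤ)) (Ak : List SL(2, ℤ))
    (hA : ∀ G : SL(2, ℤ) → A, (∀ g, G (g * T) = G g) → (∀ g, G (-g) = G g) →
      (Ak.map fun a ↦ G a - G (a * S)).sum = G k - G 1) :
    ((Ak.map fun a ↦ e * a * S).map fun f ↦ F f - F (f * S)).sum = F e - F (e * k) := by
  have h := hA (fun x ↦ F (e * x)) (fun x ↦ by simp only [← mul_assoc, hT]) (fun x ↦ by simp only [mul_neg, hneg])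
  simp only [mul_one, ← mul_assoc] at h
  have e1 : ((Ak.map fun a ↦ e * a * S).map fun f ↦ F f - F (f * S)) = Ak.map fun a ↦ -(F (e * a) - F (e * a * S)) := by
    rw [List.map_map]
    refine List.map_congr_left fun a _ ↦ ?_
    simp only [Function.comp_apply]
    rw [mul_assoc (e * a) S S, S_mul_S_eq_neg_one, mul_neg_one, hneg, neg_sub]
  have e2 : (Ak.map fun a ↦ -(F (e * a) - F (e * a * S))).sum = -(Ak.map fun a ↦ F (e * a) - F (e * a * S)).sum := by
    rw [List.sum_neg, List.map_map]
    rfl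
  rw [e1, e2, h]
  abel

/-- **Translated reversed chains are invisible to `Γ₀(N)`-invariant `S`-antisymmetric functions up to sign**:
`Σ_{a∈Ak} Φ(e·a·S) = −Σ_{a∈Ak} Φ a` for `e ∈ Γ₀(N)`, `Φ(e f) = Φ f`, `Φ(fS) = −Φ f`. [folklore] -/
theorem sum_map_translate_reverse_eq_neg {A : Type u} [AddCommGroup A] (Φ : SL(2, ℤ) → A)
    (hΦΓ : ∀ (e : Gamma0 N) (f : SL(2, ℤ)), Φ ((e : SL(2, ℤ)) * f) = Φ f) (hΦS : ∀ f, Φ (f * S) = -Φ f)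
    (e : Gamma0 N) (Ak : List SL(2, ℤ)) :
    ((Ak.map fun a ↦ (e : SL(2, ℤ)) * a * S).map Φ).sum = -(Ak.map Φ).sum := by
  rw [List.map_map, List.sum_neg, List.map_map]
  congr 1
  refine List.map_congr_left fun a _ ↦ ?_
  simp only [Function.comp_apply, hΦS, hΦΓ]

/-- **HA7b — Manin chains for a Hecke cocycle with ARBITRARY representatives, and cancellation of the anchors.** Let
`M_i` (`i` in a finite index type) be integer matrices with `det M_i ≠ 0` — ANY cusps `M_i∞` —, `σ` a permutation, `ε_i ∈ Γ₀(N)` with the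
cocycle relation `M_i·γ' = ε_i·M_{σ i}`, `L` a universal Manin chain of `γ'`, and `P` a re-expansion of generalised edges with the anchored
telescoping property of brick HA4 (`exists_convexReexpansion`) on every `M_i·g`, `g ∈ L`. Choose anchors `k_i ∈ SL₂(ℤ)` of the cusps
`M_i∞` and universal Manin chains `A_i` of the `k_i`. Then the lists
`Lε_i := A_i ++ L.flatMap (g ↦ P(M_i g)) ++ [ε_i·a·S : a ∈ A_{σ i}]` (anchor path `∞ → M_i∞`, re-expanded `M_i·L` from `M_i∞` to
`M_iγ'∞ = ε_iM_{σ i}∞`, translated anchor path back to `ε_i∞`) satisfy: (1) each `Lε_i` is a universal Manin chain of `ε_i`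
(`Σ_{f∈Lε_i} (F f − F(fS)) = F ε_i − F 1` for every cusp function `F`), so it may be fed to the crossing formula `hB` of
`exists_perfect_crossingPairing_hecke`; (2) for every left-`Γ₀(N)`-invariant, `S`-antisymmetric `Φ : SL₂(ℤ) → A` (e.g. the crossing count
`f ↦ vec D_γ [f⁻¹]` against a fixed dual chain, `dualChainVec_smul_S`) the anchor paths cancel in the sum over the cocycle:
`Σ_i Σ_{f∈Lε_i} Φ f = Σ_i Σ_{g∈L} Σ_{f∈P(M_i g)} Φ f` (because `σ` is a permutation — the Manin-side twin of HA1's `sum_dualChainVec_anchor`).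
This is what the transposed operators `T♯_q` (`q ∣ N`), whose representatives `(q 0; −Nj 1)` do not fix `∞`, need on the Manin side of
`B (U_q • x) y = B x (T♯_q y)`. [cite: Shimura1971, §3.1–3.3] [cite: Merel1994, §1.2–1.3] [cite: Manin1972, Thm. 1.6] -/
theorem exists_maninChains_of_cocycle {ι : Type} [Fintype ι] (σ : Equiv.Perm ι) (γ' : SL(2, ℤ)) (ε : ι → Gamma0 N)
    (M : ι → Matrix (Fin 2) (Fin 2) ℤ) (hM : ∀ i, (M i).det ≠ 0)
    (hcoc : ∀ i, M i * (γ' : Matrix (Fin 2) (Fin 2) ℤ) = (((ε i : Gamma0 N) : SL(2, ℤ)) : Matrix (Fin 2) (Fin 2) ℤ) * M (σ i))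
    (L : List SL(2, ℤ))
    (hL : ∀ {A : Type u} [AddCommGroup A] (G : SL(2, ℤ) → A), (∀ g, G (g * T) = G g) → (∀ g, G (-g) = G g) →
      (L.map fun g ↦ G g - G (g * S)).sum = G γ' - G 1)
    (P : Matrix (Fin 2) (Fin 2) ℤ → List SL(2, ℤ))
    (hP : ∀ i, ∀ g ∈ L, ∀ {A : Type u} [AddCommGroup A] (F : SL(2, ℤ) → A), (∀ g, F (g * T) = F g) → (∀ g, F (-g) = F g) →
      ∀ k₁ k₂ : SL(2, ℤ),
      (M i * (g : Matrix (Fin 2) (Fin 2) ℤ)) 0 0 * k₁ 1 0 = (M i * (g : Matrix (Fin 2) (Fin 2) ℤ)) 1 0 * k₁ 0 0 →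
      (M i * (g : Matrix (Fin 2) (Fin 2) ℤ)) 0 1 * k₂ 1 0 = (M i * (g : Matrix (Fin 2) (Fin 2) ℤ)) 1 1 * k₂ 0 0 →
      ((P (M i * (g : Matrix (Fin 2) (Fin 2) ℤ))).map fun f ↦ F f - F (f * S)).sum = F k₁ - F k₂) :
    ∃ Lε : ι → List SL(2, ℤ),
      (∀ i, ∀ {A : Type u} [AddCommGroup A] (F : SL(2, ℤ) → A), (∀ g, F (g * T) = F g) → (∀ g, F (-g) = F g) →
        ((Lε i).map fun f ↦ F f - F (f * S)).sum = F ((ε i : Gamma0 N) : SL(2, ℤ)) - F 1) ∧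
      ∀ {A : Type u} [AddCommGroup A] (Φ : SL(2, ℤ) → A),
        (∀ (e : Gamma0 N) (f : SL(2, ℤ)), Φ ((e : SL(2, ℤ)) * f) = Φ f) → (∀ f, Φ (f * S) = -Φ f) →
        ∑ i, ((Lε i).map Φ).sum = ∑ i, ((L.flatMap fun g : SL(2, ℤ) ↦ P (M i * (g : Matrix (Fin 2) (Fin 2) ℤ))).map Φ).sum := by
  -- anchors `k_i` of the cusps `M_i∞` and their Manin chains `A_i`
  have hcol0 : ∀ i, M i 0 0 ≠ 0 ∨ M i 1 0 ≠ 0 := fun i ↦ by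
    simpa using mul_col_ne_zero (M i) (hM i) 1
  choose k hk using fun i ↦ exists_anchor (M i 0 0) (M i 1 0) (hcol0 i)
  choose Ak hAk using fun i ↦ exists_maninChain.{u} (k i)
  refine ⟨fun i ↦ Ak i ++ (L.flatMap fun g : SL(2, ℤ) ↦ P (M i * (g : Matrix (Fin 2) (Fin 2) ℤ))) ++
      (Ak (σ i)).map (fun a ↦ ((ε i : Gamma0 N) : SL(2, ℤ)) * a * S), fun i ↦ ?_, ?_⟩
  · -- (1) `Lε_i` is a Manin chain of `ε_i`
    intro A _ F hT hneg
    -- the middle part telescopes from the anchor `k_i` of `M_i∞` to the anchor `ε_i·k_{σ i}` of `M_iγ'∞ = ε_i M_{σ i}∞`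
    have hk₁ : (M i * (γ' : Matrix (Fin 2) (Fin 2) ℤ)) 0 0 * (((ε i : Gamma0 N) : SL(2, ℤ)) * k (σ i)) 1 0 =
        (M i * (γ' : Matrix (Fin 2) (Fin 2) ℤ)) 1 0 * (((ε i : Gamma0 N) : SL(2, ℤ)) * k (σ i)) 0 0 := by
      have h := col_parallel_mul_left ((ε i : Gamma0 N) : SL(2, ℤ)) (k (σ i)) (M (σ i) 0 0) (M (σ i) 1 0) (hk (σ i))
      have e0 : ∀ r : Fin 2, (M i * (γ' : Matrix (Fin 2) (Fin 2) ℤ)) r 0 =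
          ((ε i : Gamma0 N) : SL(2, ℤ)) r 0 * M (σ i) 0 0 + ((ε i : Gamma0 N) : SL(2, ℤ)) r 1 * M (σ i) 1 0 := fun r ↦ by
        rw [hcoc i]; simp [Matrix.mul_apply, Fin.sum_univ_two]
      rw [e0 0, e0 1]
      exact h
    have hmid := flatMap_reexpansion_telescopes F hT hneg γ' (M i) (hM i) L
      (fun g : SL(2, ℤ) ↦ P (M i * (g : Matrix (Fin 2) (Fin 2) ℤ))) (fun G hGT hGn ↦ hL G hGT hGn)
      (fun g hg k₁ k₂ h1 h2 ↦ hP i g hg F hT hneg k₁ k₂ h1 h2) (k i) (((ε i : Gamma0 N) : SL(2, ℤ)) * k (σ i)) (hk i) hk₁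
    rw [List.map_append, List.map_append, List.sum_append, List.sum_append, hmid, hAk i F hT hneg,
      sum_map_translate_reverse F hT hneg _ (k (σ i)) (Ak (σ i)) (fun G hGT hGn ↦ hAk (σ i) G hGT hGn)]
    abel
  · -- (2) the anchors cancel over the permutation `σ`
    intro A _ Φ hΦΓ hΦS
    have key : ∀ i, ((Ak i ++ (L.flatMap fun g : SL(2, ℤ) ↦ P (M i * (g : Matrix (Fin 2) (Fin 2) ℤ))) ++
        (Ak (σ i)).map (fun a ↦ ((ε i : Gamma0 N) : SL(2, ℤ)) * a * S)).map Φ).sum =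
        ((Ak i).map Φ).sum + ((L.flatMap fun g : SL(2, ℤ) ↦ P (M i * (g : Matrix (Fin 2) (Fin 2) ℤ))).map Φ).sum
          - ((Ak (σ i)).map Φ).sum := by
      intro i
      rw [List.map_append, List.map_append, List.sum_append, List.sum_append,
        sum_map_translate_reverse_eq_neg Φ hΦΓ hΦS (ε i) (Ak (σ i))]
      abel
    simp only [key, Finset.sum_sub_distrib, Finset.sum_add_distrib]
    rw [Equiv.sum_comp σ (fun i ↦ ((Ak i).map Φ).sum)]
    abel

end Anchors

end Summit.BirchSwinnertonDyer.BirchSwinnertonDyer.Theorems.ThetaLayerLambdaCongruenceAtTwo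

end
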